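import Summits.CriticalPhenomena.PercolationContinuityZ3.Theorems.FK.IsingBlockDecoupling
import Summits.CriticalPhenomena.PercolationContinuityZ3.Theorems.FK.MagnetizationBlockTiling
import Summits.CriticalPhenomena.PercolationContinuityZ3.Theorems.FK.MagnetizationPhaseCoexistence
import Summits.CriticalPhenomena.PercolationContinuityZ3.Theorems.FK.MagnetizationUniformConcentration
import Summits.CriticalPhenomena.PercolationContinuityZ3.Theorems.FK.MagnetizationLargeDeviationsLower
import HarnessLib

/-!
# THE PHASE-COEXISTENCE PLATEAU: UNDER EVERY BOUNDARY CONDITION EVERY MAGNETISATION DENSITY `a ∈ [−m*(β), m*(β)]`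
# IS REACHED AT SUB-VOLUME-ORDER COST `e^{−ε|Λ_N|}` (Lanford 1973; Ellis 2006 Thm. II.6.1 / Note 13 to Ch. IV;
# Föllmer–Orey 1988)

Claimed R42 (8)(c) in the cell INBOX at 2026-08-29T11:54:27Z by fkp-10a gen 360 (NEW CLAIM #1 of the gen), addressed to the lane under (ι) (coordinator fk-4 gen 295 CLOSED l.8907 11:26:11Z 2026-08-29; «(ι) RESUMES») and to the next seated fk-4 generation (ruling R182 requested); lineage row FO-10a-g360 (self-suggested), package g360-plateau, label PL-C.
Helper file of the `fk-continuity` build cell (bschramm lane; `--supports stmt-CriticalPhenomena-4575`; fkp-10a gen 360,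
package g360-plateau, label PL-C); builds on p205010 (kernel theorem, internal audit signed; external expert review
pending). No definitions, no named facts, no sorries; standard axioms.
UNCONDITIONAL (nearest-neighbour Ising model on `ℤ^d`, `d ≥ 1`, `β > 0`, zero field, boxes
`Λ_N = {−N,…,N}^d`, EVERY boundary condition; `M_N = Σ_{x∈Λ_N} σ_x`, `m* = m*(β)` the spontaneous magnetisation).
Scope: volume-order LOWER bounds `e^{−ε|Λ_N|}` only (no surface-order rate, no rate-function object, no level-2/3
statement); nothing percolation-bearing.

The files `MagnetizationLargeDeviationsLower` / `MagnetizationPhaseCoexistence` give the large-deviation lower bound at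
every EXPOSED density (`m* < |a| < 1`) and at the two ENDPOINTS `±m*` of the coexistence plateau. This file closes
the gap: the INTERIOR of the plateau. The proof is Lanford's sub-additivity argument at volume order: tile `Λ_N` by
translates of a fixed box `Λ_n` (`MagnetizationBlockTiling`), prescribe the phase `+m*` on a fraction `(1 + a/m*)/2`
of the tiles and `−m*` on the rest, and multiply the uniform-in-the-boundary-condition window bounds at `±m*` over the
tiles by the domain Markov property (`IsingBlockDecoupling`).

* `eventually_forall_exp_le_of_surface_sub_exp` — analysis: a surface-order lower bound minus an exponentially small
  term dominates `e^{−ε|Λ_N|}` for every `ε > 0`, eventually, uniformly;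
* `diff_halfLines_subset_window(_neg)`, `measureReal_sub_le_of_diff_subset` — windows from half-lines;
* **`eventually_forall_bc_exp_le_window_plus` / `_minus`** — THE ENDPOINT WINDOWS, UNIFORMLY IN THE BOUNDARY
  CONDITION: for all `δ, ε > 0`, eventually in `n`, for ALL `bc`,
  `e^{−ε|Λ_n|} ≤ μ^{bc}_{Λ_n;β,0}{|M_n ∓ m*|Λ_n|| < δ|Λ_n|}` (LD-E's surface-order Markov bound and LD-I's uniform
  exponential tail bound beyond `±(m* + δ)`);
* **`eventually_forall_fixed_exp_le_plateau_window`** — THE PLATEAU, FIXED BOUNDARY CONDITIONS, UNIFORMLY: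
  `|a| ≤ m*(β)`, `δ, ε > 0` ⇒ eventually in `N`, for ALL `η`,
  `e^{−ε|Λ_N|} ≤ μ^{η}_{Λ_N;β,0}{|M_N/|Λ_N| − a| < δ}`;
* **`eventually_forall_bc_exp_le_plateau_window`**, `eventually_exp_le_plateau_window` — THE SAME FOR EVERY BOUNDARY
  CONDITION (free included), by the boundary-condition change of `MagnetizationPhaseCoexistence`;
* `not_eventually_plateau_window_le_exp` — hence NO density of the plateau is exponentially (in the volume) unlikely
  under any boundary condition: the finite-volume, every-b.c. form of the phenomenon behind Ellis' Note 13 to Ch. IV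
  (with `rate_nonpos_zero_field_of_abs_le_spontaneousMagnetization`: the level-1 rate function VANISHES EXACTLY on
  `[−m*, m*]` and the lower large-deviation bound holds there too, so the zero-field LDP of `M_N/|Λ_N|` is now complete
  on `(−1, 1)` for every boundary condition; the sequel `MagnetizationLDPNonzeroField` tilts it to `h ≠ 0`).

## References

* O. E. Lanford, *Entropy and equilibrium states in classical statistical mechanics*, LNP 20 (1973), §A4 (sub-additivity
  over boxes) and §B. [Lanford1973]
* R. S. Ellis, *Entropy, Large Deviations, and Statistical Mechanics*, Springer (2006), Thm. II.6.1, §IV.5–IV.6,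
  Thm. V.6.1 and Note 13 to Ch. IV (p. 117). [Ellis2006]
* H. Föllmer, S. Orey, *Large deviations for the empirical field of a Gibbs measure*, Ann. Probab. 16 (1988) 961–977,
  §2–3 (lower bound by sub-additivity, arbitrary boundary conditions at volume order). [FollmerOrey1988]
* S. Olla, *Large deviations for Gibbs random fields*, PTRF 77 (1988), Thm. 5.2. [Olla1988]
* F. Comets, C. R. Acad. Sci. Paris 303 (1986) 511–513. [Comets1986]
* S. Friedli, Y. Velenik, *Statistical Mechanics of Lattice Systems*, CUP (2017), Thm. 3.6 (proof), Prop. 3.29,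
  Exercise 6.21. [FriedliVelenik2017]
-/

noncomputable section

namespace Summit.CriticalPhenomena.PercolationContinuityZ3.Theorems.FK

namespace IsingLargeDeviations

open MeasureTheory Filter Topology Finset Set
open Literature.Probability.LatticeModels Literature.Probability.Percolation

variable {d : ℕ}

/-! ### Analysis: surface order minus exponentially small is eventually at least `e^{−ε|Λ_N|}` -/

/-- **If eventually, for all `bc`, `e^{−4|β||∂ᵉΛ_N|} κ − e^{−c|Λ_N|} ≤ f_N(bc)` (`κ, c > 0`), then for every `ε > 0`
eventually, for all `bc`, `e^{−ε|Λ_N|} ≤ f_N(bc)`** (`|∂ᵉΛ_N|/|Λ_N| → 0`). [cite: FriedliVelenik2017, §3.2.1 Exercise 3.1] -/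
theorem eventually_forall_exp_le_of_surface_sub_exp (hd : 1 ≤ d) (β : ℝ) {κ c : ℝ} (hκ : 0 < κ) (hc : 0 < c)
    {ι : Type*} {f : ℕ → ι → ℝ}
    (hf : ∀ᶠ N : ℕ in atTop, ∀ i, Real.exp (-(4 * (|β| * #(edgeBoundary (zdGraph d) (box d N))))) * κ -
        Real.exp (-(c * #(box d N))) ≤ f N i) {ε : ℝ} (hε : 0 < ε) :
    ∀ᶠ N : ℕ in atTop, ∀ i, Real.exp (-(ε * #(box d N))) ≤ f N i := by
  set ε' : ℝ := min ε c / 2 with hε'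
  have hmin : 0 < min ε c := lt_min hε hc
  have hε'pos : 0 < ε' := by positivity
  have h2c : 2 * ε' ≤ c := by rw [hε']; linarith [min_le_right ε c]
  have h2ε : 2 * ε' ≤ ε := by rw [hε']; linarith [min_le_left ε c]
  have hev1 := eventually_exp_neg_mul_card_lt hd β hκ hε'pos
  have hcard : Tendsto (fun N : ℕ => (#(box d N) : ℝ)) atTop atTop := by
    refine tendsto_atTop_mono (fun N => ?_) tendsto_natCast_atTop_atTop
    have h1 : N ≤ #(box d N) := by
      rw [card_box]
      exact (show N ≤ 2 * N + 1 by omega).trans (Nat.le_self_pow (by omega) _)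
    exact_mod_cast h1
  have hev2 : ∀ᶠ N : ℕ in atTop, Real.exp (-(ε' * (#(box d N) : ℝ))) ≤ 1 / 2 := by
    have h1 : Tendsto (fun N : ℕ => Real.exp (-(ε' * (#(box d N) : ℝ)))) atTop (𝓝 0) :=
      Real.tendsto_exp_atBot.comp (tendsto_neg_atTop_atBot.comp (hcard.const_mul_atTop hε'pos))
    exact h1.eventually (eventually_le_nhds (by norm_num))
  filter_upwards [hf, hev1, hev2] with N hN h1 h2 i
  have hV : (0 : ℝ) ≤ #(box d N) := Nat.cast_nonneg _
  set u : ℝ := Real.exp (-(ε' * (#(box d N) : ℝ))) with hu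
  have hu0 : 0 < u := Real.exp_pos _
  have h3 : Real.exp (-(c * (#(box d N) : ℝ))) ≤ u * u := by
    rw [hu, ← Real.exp_add, Real.exp_le_exp]; nlinarith
  have h4 : Real.exp (-(ε * (#(box d N) : ℝ))) ≤ u * u := by
    rw [hu, ← Real.exp_add, Real.exp_le_exp]; nlinarith
  calc Real.exp (-(ε * (#(box d N) : ℝ))) ≤ u * u := h4
    _ ≤ u * (1 / 2) := mul_le_mul_of_nonneg_left h2 hu0.le
    _ = u - u * (1 / 2) := by ring
    _ ≤ u - u * u := by gcongr
    _ ≤ Real.exp (-(4 * (|β| * #(edgeBoundary (zdGraph d) (box d N))))) * κ - Real.exp (-(c * #(box d N))) :=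
        sub_le_sub h1.le h3
    _ ≤ f N i := hN i

/-! ### Windows from half-lines -/

/-- `{(t − δ/2)V ≤ M} ∖ {(t + δ)V ≤ M} ⊆ {|M − tV| < δV}`. [folklore] -/
theorem diff_halfLines_subset_window {Ω : Type*} (M : Ω → ℝ) (V δ t : ℝ) :
    {ω | (t - δ / 2) * V ≤ M ω} \ {ω | (t + δ) * V ≤ M ω} ⊆ {ω | |M ω - t * V| < δ * V} := by
  rintro ω ⟨h1, h2⟩
  simp only [mem_setOf_eq, not_le] at h1 h2 ⊢
  rw [abs_lt]
  constructor <;> nlinarith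

/-- `{M ≤ (t + δ/2)V} ∖ {M ≤ (t − δ)V} ⊆ {|M − tV| < δV}`. [folklore] -/
theorem diff_halfLines_subset_window_neg {Ω : Type*} (M : Ω → ℝ) (V δ t : ℝ) :
    {ω | M ω ≤ (t + δ / 2) * V} \ {ω | M ω ≤ (t - δ) * V} ⊆ {ω | |M ω - t * V| < δ * V} := by
  rintro ω ⟨h1, h2⟩
  simp only [mem_setOf_eq, not_le] at h1 h2 ⊢
  rw [abs_lt]
  constructor <;> nlinarith

/-- `μ(A) − μ(D) ≤ μ(W)` whenever `A ∖ D ⊆ W` (finite measure). [folklore] -/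
theorem measureReal_sub_le_of_diff_subset {Ω : Type*} [MeasurableSpace Ω] (μ : Measure Ω) [IsFiniteMeasure μ]
    {A D W : Set Ω} (h : A \ D ⊆ W) : μ.real A - μ.real D ≤ μ.real W := by
  have hsub : A ⊆ W ∪ D := fun ω hω => by
    by_cases hD : ω ∈ D
    · exact Or.inr hD
    · exact Or.inl (h ⟨hω, hD⟩)
  linarith [measureReal_mono (μ := μ) hsub, measureReal_union_le (μ := μ) W D]

/-! ### The endpoint windows `±m*`, uniformly in the boundary condition -/

/-- **THE `+m*` WINDOW, UNIFORMLY IN THE BOUNDARY CONDITION** (`d ≥ 1`, `β > 0`): for all `δ, ε > 0`, eventually in `n`,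
for ALL `bc`, `e^{−ε|Λ_n|} ≤ μ^{bc}_{Λ_n;β,0}{|M_n − m*|Λ_n|| < δ|Λ_n|}`.
[cite: Ellis2006, Thm. V.6.1 (d)–(e); FriedliVelenik2017, Thm. 3.6 (proof); Olla1988, Thm. 5.2] -/
theorem eventually_forall_bc_exp_le_window_plus (hd : 1 ≤ d) {β : ℝ} (hβ : 0 < β) {δ : ℝ} (hδ : 0 < δ) {ε : ℝ}
    (hε : 0 < ε) :
    ∀ᶠ n : ℕ in atTop, ∀ bc : BoundaryCondition (Site d),
      Real.exp (-(ε * #(box d n))) ≤ (isingMeasure (zdGraph d) (box d n) β 0 bc).real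
        {σ | |∑ x ∈ box d n, spinAt x σ - spontaneousMagnetization d β * #(box d n)| < δ * #(box d n)} := by
  obtain ⟨c, hc, hup⟩ := upper_tail_exp_decay_uniform_of_spontaneousMagnetization_lt hd hβ
    (m := spontaneousMagnetization d β + δ) (by linarith)
  have hm1 : spontaneousMagnetization d β ≤ 1 := spontaneousMagnetization_le_one_holds (d := d) hβ.le
  have hκ : 0 < δ / 2 / (1 - spontaneousMagnetization d β + δ / 2) := by positivity
  refine eventually_forall_exp_le_of_surface_sub_exp hd β hκ hc ?_ hε
  filter_upwards [hup] with n hn bc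
  have hA := exp_mul_div_le_measureReal_ge (d := d) hβ.le (half_pos hδ) bc n
  exact (sub_le_sub hA (hn bc)).trans (measureReal_sub_le_of_diff_subset _
    (diff_halfLines_subset_window (fun σ : SpinConfig (Site d) => ∑ x ∈ box d n, spinAt x σ) _ δ
      (spontaneousMagnetization d β)))

/-- **THE `−m*` WINDOW, UNIFORMLY IN THE BOUNDARY CONDITION**: eventually in `n`, for ALL `bc`,
`e^{−ε|Λ_n|} ≤ μ^{bc}_{Λ_n;β,0}{|M_n + m*|Λ_n|| < δ|Λ_n|}`. [cite: Ellis2006, Thm. V.6.1 (d)–(e); FriedliVelenik2017, Thm. 3.6 (proof); Olla1988, Thm. 5.2] -/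
theorem eventually_forall_bc_exp_le_window_minus (hd : 1 ≤ d) {β : ℝ} (hβ : 0 < β) {δ : ℝ} (hδ : 0 < δ) {ε : ℝ}
    (hε : 0 < ε) :
    ∀ᶠ n : ℕ in atTop, ∀ bc : BoundaryCondition (Site d),
      Real.exp (-(ε * #(box d n))) ≤ (isingMeasure (zdGraph d) (box d n) β 0 bc).real
        {σ | |∑ x ∈ box d n, spinAt x σ - -spontaneousMagnetization d β * #(box d n)| < δ * #(box d n)} := by
  have hL := IsingSusceptibility.hasDerivWithinAt_pressure_field_zero_left (d := d) hd hβ.le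
  obtain ⟨c, hc, hlow⟩ := lower_tail_exp_decay_uniform_of_hasDerivWithinAt (d := d) hβ.le hL
    (m := -spontaneousMagnetization d β - δ) (by nlinarith)
  have hm1 : spontaneousMagnetization d β ≤ 1 := spontaneousMagnetization_le_one_holds (d := d) hβ.le
  have hκ : 0 < δ / 2 / (1 - spontaneousMagnetization d β + δ / 2) := by positivity
  refine eventually_forall_exp_le_of_surface_sub_exp hd β hκ hc ?_ hε
  filter_upwards [hlow] with n hn bc
  have hA := exp_mul_div_le_measureReal_le (d := d) hβ.le (half_pos hδ) bc n
  have hset : {σ : SpinConfig (Site d) | ∑ x ∈ box d n, spinAt x σ ≤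
      (-spontaneousMagnetization d β + δ / 2) * #(box d n)} \
      {σ | ∑ x ∈ box d n, spinAt x σ ≤ (-spontaneousMagnetization d β - δ) * #(box d n)} ⊆
      {σ | |∑ x ∈ box d n, spinAt x σ - -spontaneousMagnetization d β * #(box d n)| < δ * #(box d n)} :=
    diff_halfLines_subset_window_neg (fun σ : SpinConfig (Site d) => ∑ x ∈ box d n, spinAt x σ) _ δ
      (-spontaneousMagnetization d β)
  exact (sub_le_sub hA (hn bc)).trans (measureReal_sub_le_of_diff_subset _ hset)

/-! ### The plateau: fixed boundary conditions, uniformly -/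

/-- The density window is the total-spin window (variant with `V > 0` as a real hypothesis). [folklore] -/
theorem setOf_abs_div_sub_lt_eq' {Λ : Finset (Site d)} (hV : (0 : ℝ) < #Λ) {a δ : ℝ} {σ : SpinConfig (Site d)} :
    |(∑ x ∈ Λ, spinAt x σ) / #Λ - a| < δ ↔ |∑ x ∈ Λ, spinAt x σ - a * #Λ| < δ * #Λ := by
  rw [show (∑ x ∈ Λ, spinAt x σ) / #Λ - a = (∑ x ∈ Λ, spinAt x σ - a * #Λ) / #Λ by field_simp,
    abs_div, abs_of_pos hV, div_lt_iff₀ hV]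

/-- **THE PHASE-COEXISTENCE PLATEAU UNDER FIXED BOUNDARY CONDITIONS, UNIFORMLY** (`d ≥ 1`, `β > 0`, zero field): for
`|a| ≤ m*(β)` and `δ, ε > 0`, eventually in `N`, for EVERY boundary configuration `η`,
`e^{−ε|Λ_N|} ≤ μ^{η}_{Λ_N;β,0}{|M_N/|Λ_N| − a| < δ}`. Proof: tile `Λ_N` by translates of `Λ_n` (`n` fixed by the
endpoint windows with tile tolerance `δ/4`), put `+m*` on `k` tiles and `−m*` on the others with
`|m*(2k − K) − aK| ≤ 2m*`, and multiply the uniform window bounds by the domain Markov property.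
[cite: Lanford1973, §A4; FollmerOrey1988, §3; Ellis2006, Thm. II.6.1 and Note 13 to Ch. IV] -/
theorem eventually_forall_fixed_exp_le_plateau_window (hd : 1 ≤ d) {β : ℝ} (hβ : 0 < β) {a : ℝ}
    (ha : |a| ≤ spontaneousMagnetization d β) {δ : ℝ} (hδ : 0 < δ) {ε : ℝ} (hε : 0 < ε) :
    ∀ᶠ N : ℕ in atTop, ∀ η : SpinConfig (Site d),
      Real.exp (-(ε * #(box d N))) ≤ (isingMeasure (zdGraph d) (box d N) β 0 (.fixed η)).real
        {σ | |(∑ x ∈ box d N, spinAt x σ) / #(box d N) - a| < δ} := by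
  classical
  have hms0 : 0 ≤ spontaneousMagnetization d β := spontaneousMagnetization_nonneg_holds (d := d) hβ.le
  have hms1 : spontaneousMagnetization d β ≤ 1 := spontaneousMagnetization_le_one_holds (d := d) hβ.le
  have ha1 : |a| ≤ 1 := ha.trans hms1
  -- Step 1: a scale `n` with the two endpoint windows (tolerance `δ/4`, cost `ε`) for every boundary condition
  obtain ⟨n, hnp, hnm⟩ := ((eventually_forall_bc_exp_le_window_plus hd hβ (δ := δ / 4) (by positivity) hε).and
    (eventually_forall_bc_exp_le_window_minus hd hβ (δ := δ / 4) (by positivity) hε)).exists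
  have hm0 : 0 < 2 * n + 1 := by omega
  have hVn : (#(box d n) : ℝ) = ((2 * n + 1 : ℕ) : ℝ) ^ d := by rw [card_box]; push_cast; ring
  have hmd1 : (1 : ℝ) ≤ ((2 * n + 1 : ℕ) : ℝ) ^ d := one_le_pow₀ (by exact_mod_cast hm0)
  -- Step 2: the tiles of `Λ_N`
  choose A hA using fun N => exists_tiles_subset (d := d) hm0 (box d N)
  have hfrac := tendsto_card_tiles_mul_div (d := d) (fun N => #(A N)) (fun N => (hA N).2)
  have hK := tendsto_card_tiles_atTop hd hm0 (fun N => #(A N)) (fun N => (hA N).2)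
  have hev1 : ∀ᶠ N : ℕ in atTop, 1 - δ / 8 < ((#(A N) : ℝ) * ((2 * n + 1 : ℕ) : ℝ) ^ d) / #(box d N) :=
    hfrac.eventually (lt_mem_nhds (by linarith))
  have hev2 : ∀ᶠ N : ℕ in atTop, 16 / δ * ((2 * n + 1 : ℕ) : ℝ) ^ d < (#(A N) : ℝ) :=
    hK.eventually (eventually_gt_atTop _)
  filter_upwards [hev1, hev2] with N h1 h2 η
  obtain ⟨hAsub, hAle, -⟩ := hA N
  have hV : (0 : ℝ) < #(box d N) := by exact_mod_cast (box_nonempty d N).card_pos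
  have hAle' : (#(A N) : ℝ) * ((2 * n + 1 : ℕ) : ℝ) ^ d ≤ #(box d N) := by exact_mod_cast hAle
  -- Step 3: the phases of the tiles
  obtain ⟨t, ht, hsum⟩ := exists_signs_abs_sum_sub_le (A N) hms0 ha
  -- Step 4: the block events
  set E : Site d → Set (SpinConfig (Site d)) := fun v =>
    {σ | ∑ x ∈ (halfOpenBox d (2 * n + 1)).map (Site.shift (((2 * n + 1 : ℕ) : ℤ) • v)).toEmbedding, spinAt x σ ∈
      {y : ℝ | |y - t v * ((2 * n + 1 : ℕ) : ℝ) ^ d| < δ / 4 * ((2 * n + 1 : ℕ) : ℝ) ^ d}} with hE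
  have hEm : ∀ v ∈ A N, MeasurableSet (E v) := fun v _ =>
    measurable_sum_spinAt _ (measurableSet_lt (measurable_id.sub_const _).abs measurable_const)
  have hEdet : ∀ v ∈ A N, ∀ σ₁ σ₂ : SpinConfig (Site d),
      (∀ x ∈ (halfOpenBox d (2 * n + 1)).map (Site.shift (((2 * n + 1 : ℕ) : ℤ) • v)).toEmbedding, σ₁ x = σ₂ x) →
        (σ₁ ∈ E v ↔ σ₂ ∈ E v) := fun v _ σ₁ σ₂ h => by
    simp only [hE, mem_setOf_eq, sum_spinAt_congr_of_eqOn h]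
  -- each block event has probability `≥ e^{−ε (2n+1)^d}` under its own kernel, for every boundary condition
  have hEp : ∀ v ∈ A N, ∀ ζ : SpinConfig (Site d), Real.exp (-(ε * ((2 * n + 1 : ℕ) : ℝ) ^ d)) ≤
      (isingMeasure (zdGraph d) ((halfOpenBox d (2 * n + 1)).map (Site.shift (((2 * n + 1 : ℕ) : ℤ) • v)).toEmbedding)
        β 0 (.fixed ζ)).real (E v) := by
    intro v hv ζ
    have hS : MeasurableSet {y : ℝ | |y - t v * ((2 * n + 1 : ℕ) : ℝ) ^ d| < δ / 4 * ((2 * n + 1 : ℕ) : ℝ) ^ d} :=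
      measurableSet_lt (measurable_id.sub_const _).abs measurable_const
    have hbox : ∀ η' : SpinConfig (Site d), Real.exp (-(ε * ((2 * n + 1 : ℕ) : ℝ) ^ d)) ≤
        (isingMeasure (zdGraph d) (box d n) β 0 (.fixed η')).real
          {σ | ∑ x ∈ box d n, spinAt x σ ∈
            {y : ℝ | |y - t v * ((2 * n + 1 : ℕ) : ℝ) ^ d| < δ / 4 * ((2 * n + 1 : ℕ) : ℝ) ^ d}} := by
      intro η'
      rcases ht v with htv | htv
      · have := hnp (.fixed η')
        rw [hVn] at this
        simpa only [htv, mem_setOf_eq] using this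
      · have := hnm (.fixed η')
        rw [hVn] at this
        simpa only [htv, mem_setOf_eq, neg_mul] using this
    have h := forall_fixed_le_real_sum_spinAt_map_shift (d := d)
      (fun i => (n : ℤ) + ((2 * n + 1 : ℕ) : ℤ) * v i) (box d n) β 0 hS hbox ζ
    rw [← box_eq_map_shift_smul_add] at h
    exact h
  -- Step 5: probability of the intersection of the block events
  have hprob : Real.exp (-(ε * #(box d N))) ≤
      (isingMeasure (zdGraph d) (box d N) β 0 (.fixed η)).real (⋂ v ∈ A N, E v) := by
    have hp := prod_le_isingMeasure_fixed_real_biInter (zdGraph d) (A N) (Λ := box d N)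
      (fun v => (halfOpenBox d (2 * n + 1)).map (Site.shift (((2 * n + 1 : ℕ) : ℤ) • v)).toEmbedding) hAsub
      (fun v _ w _ hvw => disjoint_map_shift_halfOpenBox hm0 hvw) β 0 E hEm hEdet
      (fun _ => Real.exp (-(ε * ((2 * n + 1 : ℕ) : ℝ) ^ d))) (fun _ _ => (Real.exp_pos _).le) hEp η
    rw [Finset.prod_const] at hp
    refine le_trans ?_ hp
    rw [← Real.exp_nat_mul, Real.exp_le_exp]
    nlinarith
  -- Step 6: the intersection of the block events lies in the window
  have hsubW : (⋂ v ∈ A N, E v) ⊆ {σ | |(∑ x ∈ box d N, spinAt x σ) / #(box d N) - a| < δ} := by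
    intro σ hσ
    have hW : ∀ v ∈ A N, |∑ x ∈ (halfOpenBox d (2 * n + 1)).map (Site.shift (((2 * n + 1 : ℕ) : ℤ) • v)).toEmbedding,
        spinAt x σ - t v * ((2 * n + 1 : ℕ) : ℝ) ^ d| < δ / 4 * ((2 * n + 1 : ℕ) : ℝ) ^ d := by
      intro v hv
      have := (mem_iInter₂.1 hσ) v hv
      simpa only [hE, mem_setOf_eq] using this
    have h3 := abs_sum_spinAt_sub_le_of_tiles hm0 hAsub t σ hW
    rw [mem_setOf_eq, setOf_abs_div_sub_lt_eq' hV]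
    -- `|M − aV| ≤ |M − (Σt)m^d| + |Σt − aK| m^d + |a| (V − K m^d)`
    have hsplit : ∑ x ∈ box d N, spinAt x σ - a * #(box d N) =
        (∑ x ∈ box d N, spinAt x σ - (∑ v ∈ A N, t v) * ((2 * n + 1 : ℕ) : ℝ) ^ d) +
          ((∑ v ∈ A N, t v - a * #(A N)) * ((2 * n + 1 : ℕ) : ℝ) ^ d +
            a * ((#(A N) : ℝ) * ((2 * n + 1 : ℕ) : ℝ) ^ d - #(box d N))) := by ring
    have h4 : |(∑ v ∈ A N, t v - a * #(A N)) * ((2 * n + 1 : ℕ) : ℝ) ^ d| ≤ 2 * ((2 * n + 1 : ℕ) : ℝ) ^ d := by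
      rw [abs_mul, abs_of_nonneg (by positivity : (0 : ℝ) ≤ ((2 * n + 1 : ℕ) : ℝ) ^ d)]
      exact mul_le_mul_of_nonneg_right (hsum.trans (by linarith)) (by positivity)
    have h5 : |a * ((#(A N) : ℝ) * ((2 * n + 1 : ℕ) : ℝ) ^ d - #(box d N))| ≤
        (#(box d N) : ℝ) - #(A N) * ((2 * n + 1 : ℕ) : ℝ) ^ d := by
      rw [abs_mul, abs_sub_comm,
        abs_of_nonneg (by linarith : (0 : ℝ) ≤ (#(box d N) : ℝ) - #(A N) * ((2 * n + 1 : ℕ) : ℝ) ^ d)]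
      exact mul_le_of_le_one_left (by linarith) ha1
    have h6 : (1 - δ / 8) * #(box d N) < (#(A N) : ℝ) * ((2 * n + 1 : ℕ) : ℝ) ^ d := by
      rwa [lt_div_iff₀ hV] at h1
    have h7 : 2 * ((2 * n + 1 : ℕ) : ℝ) ^ d < δ / 8 * #(box d N) := by
      have h8 : 16 / δ * ((2 * n + 1 : ℕ) : ℝ) ^ d * 1 < (#(A N) : ℝ) * ((2 * n + 1 : ℕ) : ℝ) ^ d :=
        (mul_le_of_le_one_right (by positivity) le_rfl).trans_lt
          (h2.trans_le (le_mul_of_one_le_right (Nat.cast_nonneg _) hmd1))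
      have h9 : 16 / δ * ((2 * n + 1 : ℕ) : ℝ) ^ d < #(box d N) := by linarith
      have := mul_lt_mul_of_pos_left h9 (by positivity : (0 : ℝ) < δ / 8)
      rw [show δ / 8 * (16 / δ * ((2 * n + 1 : ℕ) : ℝ) ^ d) = 2 * ((2 * n + 1 : ℕ) : ℝ) ^ d by
        field_simp; ring] at this
      exact this
    rw [hsplit]
    refine (abs_add_le _ _).trans_lt ?_
    have := abs_add_le ((∑ v ∈ A N, t v - a * #(A N)) * ((2 * n + 1 : ℕ) : ℝ) ^ d)
      (a * ((#(A N) : ℝ) * ((2 * n + 1 : ℕ) : ℝ) ^ d - #(box d N)))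
    nlinarith [h3, h4, h5, h6, h7, hδ]
  exact hprob.trans (measureReal_mono hsubW)

/-! ### The plateau under every boundary condition -/

/-- **THE PHASE-COEXISTENCE PLATEAU UNDER EVERY BOUNDARY CONDITION, UNIFORMLY** (`d ≥ 1`, `β > 0`, `h = 0`): for
`|a| ≤ m*(β)` and `δ, ε > 0`, eventually in `N`, for EVERY boundary condition (free, `±`, any fixed `η`),
`e^{−ε|Λ_N|} ≤ μ^{bc}_{Λ_N;β,0}{|M_N/|Λ_N| − a| < δ}` — the large-deviation lower bound on the whole plateau, where the
rate function vanishes (`rate_nonpos_zero_field_of_abs_le_spontaneousMagnetization`).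
[cite: Lanford1973, §A4; FollmerOrey1988, §3; Ellis2006, Thm. II.6.1, Thm. V.6.1 and Note 13 to Ch. IV] -/
theorem eventually_forall_bc_exp_le_plateau_window (hd : 1 ≤ d) {β : ℝ} (hβ : 0 < β) {a : ℝ}
    (ha : |a| ≤ spontaneousMagnetization d β) {δ : ℝ} (hδ : 0 < δ) {ε : ℝ} (hε : 0 < ε) :
    ∀ᶠ N : ℕ in atTop, ∀ bc : BoundaryCondition (Site d),
      Real.exp (-(ε * #(box d N))) ≤ (isingMeasure (zdGraph d) (box d N) β 0 bc).real
        {σ | |(∑ x ∈ box d N, spinAt x σ) / #(box d N) - a| < δ} := by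
  have h1 := eventually_forall_fixed_exp_le_plateau_window hd hβ ha hδ (half_pos hε)
  have h2 := eventually_exp_neg_mul_card_lt hd β one_pos (half_pos hε)
  filter_upwards [h1, h2] with N hN h2N bc
  have hS : MeasurableSet {y : ℝ | |y / #(box d N) - a| < δ} :=
    measurableSet_lt ((measurable_id.div_const _).sub_const _).abs measurable_const
  have hchange := measureReal_sum_spinAt_mem_le_exp_mul (zdGraph d) (box d N) β 0 .plus bc hS
  have hplus : Real.exp (-(ε / 2 * #(box d N))) ≤ (isingMeasure (zdGraph d) (box d N) β 0 .plus).real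
      {σ | ∑ x ∈ box d N, spinAt x σ ∈ {y : ℝ | |y / #(box d N) - a| < δ}} := hN 1
  set B : ℝ := 4 * (|β| * (#(edgeBoundary (zdGraph d) (box d N)) : ℝ)) with hB
  calc Real.exp (-(ε * #(box d N)))
      = Real.exp (-(ε / 2 * #(box d N))) * Real.exp (-(ε / 2 * #(box d N))) := by
        rw [← Real.exp_add]; congr 1; ring
    _ ≤ (Real.exp (-B) * 1) * (Real.exp B * (isingMeasure (zdGraph d) (box d N) β 0 bc).real
          {σ | ∑ x ∈ box d N, spinAt x σ ∈ {y : ℝ | |y / #(box d N) - a| < δ}}) :=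
        mul_le_mul h2N.le (hplus.trans hchange) (Real.exp_pos _).le (by positivity)
    _ = (isingMeasure (zdGraph d) (box d N) β 0 bc).real
          {σ | |(∑ x ∈ box d N, spinAt x σ) / #(box d N) - a| < δ} := by
        rw [mul_one, ← mul_assoc, ← Real.exp_add, neg_add_cancel, Real.exp_zero, one_mul]
        rfl

/-- **THE PLATEAU, ONE BOUNDARY CONDITION AT A TIME** (the form matching `ld_lower_zero_field`): for `|a| ≤ m*(β)`,
`δ, ε > 0` and every `bc`, eventually `e^{−ε|Λ_N|} ≤ μ^{bc}_{Λ_N;β,0}{|M_N/|Λ_N| − a| < δ}`.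
[cite: Lanford1973, §A4; Ellis2006, Thm. II.6.1 and Note 13 to Ch. IV] -/
theorem eventually_exp_le_plateau_window (hd : 1 ≤ d) {β : ℝ} (hβ : 0 < β) {a : ℝ}
    (ha : |a| ≤ spontaneousMagnetization d β) {δ : ℝ} (hδ : 0 < δ) {ε : ℝ} (hε : 0 < ε)
    (bc : BoundaryCondition (Site d)) :
    ∀ᶠ N : ℕ in atTop,
      Real.exp (-(ε * #(box d N))) ≤ (isingMeasure (zdGraph d) (box d N) β 0 bc).real
        {σ | |(∑ x ∈ box d N, spinAt x σ) / #(box d N) - a| < δ} := by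
  filter_upwards [eventually_forall_bc_exp_le_plateau_window hd hβ ha hδ hε] with N hN using hN bc

/-- **NO PLATEAU DENSITY IS EXPONENTIALLY UNLIKELY**: for `|a| ≤ m*(β)`, `δ > 0`, `c > 0` and every boundary condition
it is NOT the case that eventually `μ^{bc}_{Λ_N;β,0}{|M_N/|Λ_N| − a| < δ} ≤ e^{−c|Λ_N|}` (in particular, for
`β > β_c` the densities strictly between the pure phases `±m*` are reached at sub-volume-order cost).
[cite: Ellis2006, Note 13 to Ch. IV and Thm. IV.6.6 (b); FollmerOrey1988, §3] -/
theorem not_eventually_plateau_window_le_exp (hd : 1 ≤ d) {β : ℝ} (hβ : 0 < β) {a : ℝ}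
    (ha : |a| ≤ spontaneousMagnetization d β) {δ : ℝ} (hδ : 0 < δ) {c : ℝ} (hc : 0 < c)
    (bc : BoundaryCondition (Site d)) :
    ¬ ∀ᶠ N : ℕ in atTop, (isingMeasure (zdGraph d) (box d N) β 0 bc).real
        {σ | |(∑ x ∈ box d N, spinAt x σ) / #(box d N) - a| < δ} ≤ Real.exp (-(c * #(box d N))) := by
  intro h
  obtain ⟨N, hN1, hN2⟩ := ((eventually_exp_le_plateau_window hd hβ ha hδ (half_pos hc) bc).and h).exists
  have hV : (1 : ℝ) ≤ #(box d N) := by exact_mod_cast (box_nonempty d N).card_pos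
  have := (hN1.trans hN2)
  rw [Real.exp_le_exp] at this
  nlinarith

end IsingLargeDeviations

end Summit.CriticalPhenomena.PercolationContinuityZ3.Theorems.FK
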